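import Summits.Schanuel.Schanuel.Theorems.RootDecomp1KLevelFinite02

/-!
# RootDecomp1KLevelFinite — lens 1, generation 51, node 10 «LEVEL FINITENESS: the thin-fibre residual ThinFibre m₀ (ALL P ≠ 0, EVERY m₀ ≥ 2) GRADED BY SIEGEL'S EXCEPTIONAL CLASSES» — continuation (RootDecomp1KLevelFinite03): §4 the assembly + §5 the two-rational-poles shape (proved, hyp-free)

(lens-1 g51 HOME kernel K = HOME/decomp-schanuel-lens-1/g51/LevelFinite.lean b1fbaeff…, 843 l, ONE import …RootDecomp1KXLinear05 BY NAME; P LevelFiniteProbe.lean 6077dbab… rc 0 / C₀ LevelFiniteCtrl0.lean 388c6d35… rc 0 / C LevelFiniteCtrl.lean 6b696b71… rc 1 = 16 planted; memo NODE-g51.md ed9ba755…; CLAIM L2477, EX-ANTE PRICE + CHECKLIST K-g51 L2478, NODE L2479 / REQUEST L2480, writer re-check L2481, critic VERDICT L2482: CLEARED AS PRICED EX ANTE — ONE THEOREM ×1 «LEVEL-FINITENESS REDUCTION», RULE K-R40, PORT GO. Port by census-1 gen 21 as `RootDecomp1KLevelFinite01–04` along K's §0–§7: 01 = §0 the truncations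 `sQ` + §1 `LevelFinite` (def) and the PROVED glue `thinFibre_of_levelFinite` / (b); 02 = §2 the Siegel–Mahler trichotomy typed to consumption shape (`IsDyadic`, `NormShapeHyp`, `SiegelShapes` [requested Literature fact, cite item wi-102309], `LaurentShapeLF`, `TwoAdicBounded`, `NormShapeLFNonsplit`, `NormShapeLFSplitImag` [hypothesis, ATTACKABLE], `NormShapeLFSplitReal` [hypothesis, FACT-NEEDED, cite item wi-102310], `NormShapeLevels`) + §3 the one-pole shape PROVED from the tree's `levels_finite` (Ridout by tree name); 03 = §4 the assembly `levelFinite_of_siegelShapes` / `thinFibre_of_siegelShapes` / `b_of_siegelShapes` + §5 the two-rational-poles shape PROVED hyp-free (`laurentShapeLF_holds`); 04 = §6 headline corollaries + §7 the non-split conjugate-poles grade PROVED (`normShapeLFNonsplit_holds`) and the primed headline corollaries. PORT EDITS (census convention, pre-sanctioned L2482): `isCoprime_num_den` PRIVATISED (verbatim twin of `Literature.NumberTheory.DiophantineApproximation.SparseDyadicRationals.isCoprime_num_den`, writer flag (α)); `padicValInt_two_pow` (v₂(xⁿ) = n·v₂(x)) privatised + documented (generic one-liner; a DIFFERENT statement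 under the same short name is private in CollarCell01 / CollarWall01); docstrings added on `thinFibre_of_siegelShapes'` / `b_of_siegelShapes'`; the two «[cite …]» brackets inside the docstrings of the HYPOTHESIS defs `SiegelShapes` / `NormShapeLFSplitReal` re-punctuated to «(sources: …)» so that the gate does not RELOCATE these consumption-shape hypothesis statements into Literature/Uncategorized (first filing p841087 was relocated and bounced there: an inline-cited `def … : Prop` is treated as a Literature fact; these are NOT verbatim print — cite-kind items wi-102309 / wi-102310 track the facts), text otherwise unchanged; per-part private copies if any; K carries no `set_option` (its 52 dupNamespace lint warnings are HOME-path artefacts, 0 in the tree build); statements and proofs otherwise verbatim, no renames, no heartbeat lines. `--supports stmt-Schanuel-33364`; no census credit carried; rung 0 — nothing here proves Schanuel, 33364, 31077, 33363, ThinFibre m₀ or the (b)-cell hypothesis-free.)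
-/

noncomputable section

open Polynomial LiouvilleNumber
open scoped Nat

namespace Summit.Schanuel.Schanuel.Theorems.RootDecomp1KLevelFinite

open Summit.Schanuel.Schanuel.Theorems.RootDecomp1KSkelCell (iota SkelLiouville SkelLiouvilleFix
  skelLiouville_iff_fix SkelLiouvilleFix.mono)
open Summit.Schanuel.Schanuel.Theorems.RootDecomp1KTwoBaseCell (psNumer partialSum_eq_psNumer_div coprime_psNumer
  sb_of_range_eq')
open Summit.Schanuel.Schanuel.Theorems.RootDecomp1KRelLiouvilleCell (partialSum_two_strictMono)
open Summit.Schanuel.Schanuel.Theorems.RootDecomp1KDegreeLadder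
open Summit.Schanuel.Schanuel.Theorems.RootDecomp1KXLinear (xLinP bev_xLinP aeval_ratCast levels_finite
  thinFibreAt_mul_left)
open Summit.Schanuel.Schanuel.Theorems.RootDecomp1KHyper (SB SFset sb_of_algebraicIndependent)

/-! ## §4  THE ASSEMBLY: shapes ⟹ LEVEL FINITENESS for every prime curve ⟹ ThinFibre (m₀ ≥ 2) ⟹ (b) ⟹ cells -/

/-- **LEVEL FINITENESS OF EVERY PRIME CURVE OF `Y`-DEGREE `≥ 2` FROM THE SHAPES** (PROVED modulo the named inputs:
`SiegelShapes` BY NAME, the two-rational-poles piece `LaurentShapeLF` BY NAME, the three conjugate-poles grades BY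
NAME; the one-pole piece `polyShapeLF` is PROVED). -/
theorem levelFinite_of_shapes (hS : SiegelShapes) (hL : LaurentShapeLF) (h₁ : NormShapeLFNonsplit)
    (h₂ : NormShapeLFSplitImag) (h₃ : NormShapeLFSplitReal) :
    ∀ P : ℤ[X][X], Prime P → 2 ≤ P.natDegree → LevelFinite P := by
  intro P hP hd C₀
  have key : ∀ N ∈ LevelSet P C₀, ∃ r : ℚ, bev P (sQ N) r = 0 := by
    rintro N ⟨r, -, h, -⟩
    exact ⟨r, by rwa [sQ_cast]⟩
  rcases hS P hP hd with hA | ⟨f, D, E, hf, hD, hB⟩ | ⟨g, a, D, E, ha, hag, hg0, hD, hB⟩ | ⟨g, q, a, D, E, hH, hB⟩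
  · refine (finite_levels_of_finite hA).subset fun N hN => ?_
    obtain ⟨r, hr⟩ := key N hN
    exact ⟨isDyadic_sQ N, r, hr⟩
  · refine ((finite_levels_of_finite E.finite_toSet).union (polyShapeLF f hf D hD)).subset fun N hN => ?_
    obtain ⟨r, hr⟩ := key N hN
    rcases hB _ _ hr with h | ⟨t, ht⟩
    · exact Or.inl h
    · exact Or.inr ⟨t, ht⟩
  · refine ((finite_levels_of_finite E.finite_toSet).union (hL g a D ha hag hg0 hD)).subset fun N hN => ?_
    obtain ⟨r, hr⟩ := key N hN
    rcases hB _ _ hr with h | ⟨t, ht0, ht⟩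
    · exact Or.inl h
    · exact Or.inr ⟨t, ht0, ht⟩
  · refine ((finite_levels_of_finite E.finite_toSet).union
      (normShapeLevels_finite_of_grades h₁ h₂ h₃ g q a D hH)).subset fun N hN => ?_
    obtain ⟨r, hr⟩ := key N hN
    rcases hB _ _ hr with h | ⟨t, ht⟩
    · exact Or.inl h
    · exact Or.inr ⟨t, ht⟩

/-- **UNIFORM THIN FIBRES (K-R36 (ii)) AT EVERY QUALITY `m₀ ≥ 2`, MODULO THE NAMED INPUTS.** -/
theorem thinFibre_of_shapes (hS : SiegelShapes) (hL : LaurentShapeLF) (h₁ : NormShapeLFNonsplit)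
    (h₂ : NormShapeLFSplitImag) (h₃ : NormShapeLFSplitReal) {m₀ : ℕ} (hm : 2 ≤ m₀) : ThinFibre m₀ :=
  thinFibre_of_levelFinite (levelFinite_of_shapes hS hL h₁ h₂ h₃) hm

/-- **THE (b)-CELL (K-R36 (iii)) AT EVERY FIXED QUALITY `m₀ ≥ 2`, MODULO THE NAMED INPUTS**: algebraic independence
of `(ℓ₂, ρ)` for every `ρ ∈ SkelFix m₀`. -/
theorem b_of_shapes (hS : SiegelShapes) (hL : LaurentShapeLF) (h₁ : NormShapeLFNonsplit)
    (h₂ : NormShapeLFSplitImag) (h₃ : NormShapeLFSplitReal) {m₀ : ℕ} (hm : 2 ≤ m₀) (ρ : ℝ)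
    (hρ : SkelLiouvilleFix m₀ ρ) : AlgebraicIndependent ℚ ![((liouvilleNumber 2 : ℝ) : ℂ), (ρ : ℂ)] :=
  b_of_levelFinite (levelFinite_of_shapes hS hL h₁ h₂ h₃) hm ρ hρ

/-- **ITEM 31077 ON THE PAIR `(ℓ₂, ρ)`, `ρ ∈ SkelFix m₀`, `m₀ ≥ 2`, MODULO THE NAMED INPUTS** (binders VERBATIM +
one cell line). -/
theorem coordLiouvilleSchanuel_pair_of_shapes (hS : SiegelShapes) (hL : LaurentShapeLF)
    (h₁ : NormShapeLFNonsplit) (h₂ : NormShapeLFSplitImag) (h₃ : NormShapeLFSplitReal)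
    {m₀ : ℕ} (hm : 2 ≤ m₀) {ρ : ℝ} (hρ : SkelLiouvilleFix m₀ ρ) :
    ∀ (n : ℕ) (z : Fin n → ℂ), LinearIndependent ℚ z →
      Set.range z = Set.range ![((liouvilleNumber 2 : ℝ) : ℂ), (ρ : ℂ)] →
      (∃ w ∈ Submodule.span ℚ (Set.range z), Liouville w.re ∨ Liouville w.im) →
      (n : Cardinal) ≤ Algebra.trdeg ℚ
        ↥(IntermediateField.adjoin ℚ (Set.range z ∪ Set.range (Complex.exp ∘ z))) :=
  coordLiouvilleSchanuel_pair_of_levelFinite (levelFinite_of_shapes hS hL h₁ h₂ h₃) hm hρ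

/-! ## §5  THE TWO-RATIONAL-POLES SHAPE — PROVED (hypothesis-free, elementary) -/

/-- Rationals of bounded size and bounded denominator form a finite set. -/
theorem finite_rat_of_abs_le_den_le (C B : ℝ) : {r : ℚ | |(r : ℝ)| ≤ C ∧ (r.den : ℝ) ≤ B}.Finite := by
  classical
  obtain ⟨D, hD⟩ : ∃ D : ℕ, B ≤ D := exists_nat_ge _
  obtain ⟨K, hK⟩ : ∃ K : ℕ, |C| * D ≤ K := exists_nat_ge _
  apply Set.Finite.subset (((Set.finite_Icc (-(K : ℤ)) K).prod (Set.finite_Icc (0 : ℕ) D)).image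
    (fun p : ℤ × ℕ => (p.1 : ℚ) / p.2))
  rintro r ⟨hrC, hB⟩
  have hden : r.den ≤ D := by exact_mod_cast hB.trans hD
  have hnum : |(r.num : ℝ)| ≤ K := by
    have e1 : (r.num : ℝ) = (r : ℝ) * r.den := by
      have := Rat.mul_den_eq_num r
      exact_mod_cast this.symm
    rw [e1, abs_mul]
    have hC : 0 ≤ C := (abs_nonneg _).trans hrC
    calc |(r : ℝ)| * |(r.den : ℝ)| ≤ C * D := by
          rw [abs_of_nonneg (by positivity : (0 : ℝ) ≤ r.den)]
          exact mul_le_mul hrC (by exact_mod_cast hden) (by positivity) hC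
      _ ≤ |C| * D := by gcongr; exact le_abs_self C
      _ ≤ K := hK
  refine ⟨(r.num, r.den), ⟨⟨?_, ?_⟩, ⟨Nat.zero_le _, hden⟩⟩, Rat.num_div_den r⟩
  · have : (-(K : ℝ)) ≤ r.num := (abs_le.mp hnum).1
    exact_mod_cast this
  · have : (r.num : ℝ) ≤ K := (abs_le.mp hnum).2
    exact_mod_cast this

/-- Growth: if `deg Q < deg G` then `|G(s)/Q(s)| > M` for all real `s` of large absolute value. -/
theorem exists_abs_div_gt (G Q : ℝ[X]) (hdeg : Q.degree < G.degree) (hQ : Q ≠ 0) (M : ℝ) :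
    ∃ c : ℝ, 0 < c ∧ ∀ s : ℝ, c < |s| → M < |eval s G / eval s Q| := by
  obtain ⟨a, ha⟩ := Filter.tendsto_atTop_atTop.1
    (Polynomial.abs_div_tendsto_atTop_atTop_of_degree_gt G Q hdeg hQ) (M + 1)
  obtain ⟨b, hb⟩ := Filter.tendsto_atBot_atTop.1
    (Polynomial.abs_div_tendsto_atBot_atTop_of_degree_gt G Q hdeg hQ) (M + 1)
  refine ⟨max 1 (max |a| |b|), by positivity, fun s hs => ?_⟩
  have hm : max |a| |b| < |s| := lt_of_le_of_lt (le_max_right _ _) hs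
  rcases le_or_gt 0 s with h0 | h0
  · rw [abs_of_nonneg h0] at hm
    have : a ≤ s := by linarith [le_abs_self a, le_max_left |a| |b|]
    linarith [ha s this]
  · rw [abs_of_neg h0] at hm
    have : s ≤ b := by linarith [neg_abs_le b, le_max_right |a| |b|]
    linarith [hb s this]

/-- The cleared-denominator form of the two-rational-poles level equation: with `t = u/v` in lowest terms and
`d = deg g`, `u ∣ 2^{N!}·g(0)` and `v ∣ 2^{N!}·lc(g)`. -/
theorem num_den_dvd_of_laurentLevel {g : ℤ[X]} {a : ℕ} {D : ℤ} {t : ℚ} {N : ℕ} (ha : 1 ≤ a)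
    (had : a < g.natDegree) (h : aeval t g = D * sQ N * t ^ a) :
    t.num ∣ 2 ^ N ! * g.coeff 0 ∧ (t.den : ℤ) ∣ 2 ^ N ! * g.leadingCoeff := by
  classical
  set d := g.natDegree with hd
  set u : ℤ := t.num with hu
  set v : ℤ := (t.den : ℤ) with hv
  have hv0 : (v : ℚ) ≠ 0 := by rw [hv]; exact_mod_cast t.den_nz
  have htuv : (t : ℚ) = (u : ℚ) / (v : ℚ) := by rw [hu, hv]; exact_mod_cast (Rat.num_div_den t).symm
  -- the integer `G = v^d · g(t)`
  set G : ℤ := ∑ i ∈ Finset.range (d + 1), g.coeff i * u ^ i * v ^ (d - i) with hG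
  have hGq : (G : ℚ) = (v : ℚ) ^ d * aeval t g := by
    rw [aeval_eq_sum_range, Finset.mul_sum, hG]
    push_cast
    refine Finset.sum_congr rfl fun i hi => ?_
    have hi' : i ≤ d := Nat.lt_succ_iff.mp (Finset.mem_range.mp hi)
    obtain ⟨k, hk⟩ := Nat.exists_eq_add_of_le hi'
    rw [hk, Nat.add_sub_cancel_left, zsmul_eq_mul, htuv, div_pow, pow_add]
    field_simp
  -- the integer equation
  have hEq : (2 : ℤ) ^ N ! * G = D * (psNumer 2 N : ℤ) * u ^ a * v ^ (d - a) := by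
    obtain ⟨k, hk⟩ := Nat.exists_eq_add_of_le had.le
    have h2 : (2 : ℚ) ^ N ! ≠ 0 := by positivity
    have : ((2 : ℤ) ^ N ! * G : ℤ) = ((D * (psNumer 2 N : ℤ) * u ^ a * v ^ (d - a) : ℤ) : ℚ) := by
      push_cast
      rw [hGq, h, sQ, htuv, hk, Nat.add_sub_cancel_left, div_pow, pow_add]
      field_simp
    exact_mod_cast this
  -- coprimality
  have hcop : IsCoprime u v := by
    rw [Int.isCoprime_iff_gcd_eq_one, Int.gcd_eq_natAbs, hu, hv, Int.natAbs_natCast]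
    exact t.reduced
  constructor
  · -- u ∣ 2^{N!} G and u ∣ G - g₀ v^d
    have hu1 : u ∣ 2 ^ N ! * G := by
      rw [hEq]
      obtain ⟨a', ha'⟩ := Nat.exists_eq_add_of_le ha
      rw [ha', pow_add, pow_one]
      exact ⟨D * (psNumer 2 N : ℤ) * u ^ a' * v ^ (d - (1 + a')), by ring⟩
    have hu2 : u ∣ G - g.coeff 0 * v ^ d := by
      rw [hG, Finset.sum_range_succ']
      simp only [pow_zero, mul_one, Nat.sub_zero, add_sub_cancel_right]
      refine Finset.dvd_sum fun i _ => ?_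
      rw [pow_succ]
      exact ⟨u ^ i * g.coeff (i + 1) * v ^ (d - (i + 1)), by ring⟩
    have hu3 : u ∣ 2 ^ N ! * g.coeff 0 * v ^ d := by
      have := dvd_sub hu1 (Dvd.dvd.mul_left hu2 (2 ^ N !))
      rw [show (2 : ℤ) ^ N ! * G - 2 ^ N ! * (G - g.coeff 0 * v ^ d) = 2 ^ N ! * g.coeff 0 * v ^ d by ring]
        at this
      exact this
    exact (hcop.pow_right (n := d)).dvd_of_dvd_mul_right hu3
  · have hv1 : v ∣ 2 ^ N ! * G := by
      rw [hEq]
      obtain ⟨k, hk⟩ := Nat.exists_eq_add_of_le (Nat.succ_le_of_lt (Nat.sub_pos_of_lt had))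
      rw [hk, pow_add, pow_one]
      exact ⟨v ^ k * D * (psNumer 2 N : ℤ) * u ^ a, by ring⟩
    have hv2 : v ∣ G - g.leadingCoeff * u ^ d := by
      rw [hG, Finset.sum_range_succ, Polynomial.leadingCoeff, ← hd]
      simp only [Nat.sub_self, pow_zero, mul_one, add_sub_cancel_right]
      refine Finset.dvd_sum fun i hi => ?_
      obtain ⟨k, hk⟩ := Nat.exists_eq_add_of_le (Nat.succ_le_of_lt (Nat.sub_pos_of_lt (Finset.mem_range.mp hi)))
      rw [hk, pow_add, pow_one]
      exact ⟨v ^ k * g.coeff i * u ^ i, by ring⟩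
    have hv3 : v ∣ 2 ^ N ! * g.leadingCoeff * u ^ d := by
      have := dvd_sub hv1 (Dvd.dvd.mul_left hv2 (2 ^ N !))
      rw [show (2 : ℤ) ^ N ! * G - 2 ^ N ! * (G - g.leadingCoeff * u ^ d)
          = 2 ^ N ! * g.leadingCoeff * u ^ d by ring] at this
      exact this
    exact (hcop.symm.pow_right (n := d)).dvd_of_dvd_mul_right hv3

/-- Numerator and denominator of a rational are coprime integers. -/
private theorem isCoprime_num_den (t : ℚ) : IsCoprime t.num (t.den : ℤ) := by
  rw [Int.isCoprime_iff_gcd_eq_one, Int.gcd_eq_natAbs, Int.natAbs_natCast]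
  exact t.reduced

/-- **THE TWO-RATIONAL-POLES SHAPE — PROVED (hypothesis-free, elementary).**  For `g ∈ ℤ[t]` with `g(0) ≠ 0`,
`1 ≤ a < deg g` and `D ≠ 0`, only finitely many truncations satisfy `g(t) = D·s_N·t^a` with `t ∈ ℚ^×`:
ARCHIMEDEAN — `|g(t)/t^a| → ∞` as `|t| → ∞` (`deg g > a`) and as `t → 0` (reverse polynomial, `g(0) ≠ 0`,
`a ≥ 1`) while `|D·s_N| ≤ 2|D|`, so `1/c₃ ≤ |t| ≤ c₂`; ARITHMETIC — with `t = u/v` in lowest terms,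
`u ∣ 2^{N!} g(0)` and `v ∣ 2^{N!} lc(g)` (`num_den_dvd_of_laurentLevel`), and `u`, `v` are not both even, so
either `v ∣ lc(g)` or `u ∣ g(0)`; either way the denominator is bounded, the parameters `t` form a finite set, and
each `t` carries at most one level (`sQ_injective`). -/
theorem laurentShapeLF_holds : LaurentShapeLF := by
  intro g a D ha had hg0 hD
  classical
  set d := g.natDegree with hd
  have hg : g ≠ 0 := by
    rintro rfl
    simp at hg0
  have hlc : g.leadingCoeff ≠ 0 := leadingCoeff_ne_zero.mpr hg
  -- the real polynomial and its reverse
  set gR : ℝ[X] := g.map (Int.castRingHom ℝ) with hgR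
  have hgRdeg : gR.natDegree = d := by rw [hgR, natDegree_map_eq_of_injective Int.cast_injective]
  have hgR0 : gR ≠ 0 := by
    rw [hgR, Ne, Polynomial.map_eq_zero_iff Int.cast_injective]
    exact hg
  have hev : ∀ t : ℝ, aeval t g = eval t gR := fun t => by
    rw [hgR, eval_map, aeval_def, algebraMap_int_eq]
  have hgRc0 : gR.coeff 0 ≠ 0 := by
    rw [hgR, coeff_map]
    simp only [eq_intCast, ne_eq, Int.cast_eq_zero]
    exact hg0
  set gv : ℝ[X] := gR.reverse with hgv
  have hgvdeg : gv.natDegree = d := by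
    rw [hgv, reverse_natDegree, hgRdeg, natTrailingDegree_eq_zero.mpr (Or.inr hgRc0), Nat.sub_zero]
  have hgv0 : gv ≠ 0 := by
    intro h0
    rw [h0, natDegree_zero] at hgvdeg
    omega
  have hdeg1 : (X ^ a : ℝ[X]).degree < gR.degree := by
    rw [degree_X_pow, degree_eq_natDegree hgR0, hgRdeg]
    exact_mod_cast had
  have hdeg2 : (X ^ (d - a) : ℝ[X]).degree < gv.degree := by
    rw [degree_X_pow, degree_eq_natDegree hgv0, hgvdeg]
    exact_mod_cast Nat.sub_lt (by omega) (by omega)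
  set M : ℝ := 2 * |(D : ℝ)| with hM
  obtain ⟨c₂, hc₂, hup⟩ := exists_abs_div_gt gR (X ^ a) hdeg1 (pow_ne_zero _ X_ne_zero) M
  obtain ⟨c₃, hc₃, hlow⟩ := exists_abs_div_gt gv (X ^ (d - a)) hdeg2 (pow_ne_zero _ X_ne_zero) M
  have hDs : ∀ N : ℕ, |(D : ℝ) * ((sQ N : ℚ) : ℝ)| ≤ M := by
    intro N
    rw [abs_mul, hM]
    have h2 : |((sQ N : ℚ) : ℝ)| ≤ 2 := by exact_mod_cast abs_sQ_le N
    nlinarith [abs_nonneg (D : ℝ), abs_nonneg ((sQ N : ℚ) : ℝ)]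
  -- the set of parameters is finite
  have hT : {t : ℚ | t ≠ 0 ∧ ∃ N : ℕ, aeval t g = D * sQ N * t ^ a}.Finite := by
    apply (finite_rat_of_abs_le_den_le c₂
      (max ((g.leadingCoeff.natAbs : ℕ) : ℝ) ((((g.coeff 0).natAbs : ℕ) : ℝ) * c₃))).subset
    rintro t ⟨ht0, N, hN⟩
    have ht0' : (t : ℝ) ≠ 0 := by exact_mod_cast ht0
    have hNR : eval (t : ℝ) gR = (D : ℝ) * ((sQ N : ℚ) : ℝ) * (t : ℝ) ^ a := by
      rw [← hev, ← aeval_ratCast, hN]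
      push_cast
      ring
    -- archimedean upper bound
    have hupt : |(t : ℝ)| ≤ c₂ := by
      by_contra hc
      push Not at hc
      have h1 := hup (t : ℝ) hc
      rw [eval_pow, eval_X, hNR, mul_div_assoc, div_self (pow_ne_zero _ ht0'), mul_one] at h1
      linarith [hDs N]
    -- archimedean lower bound, as an upper bound for `|1/t|`
    have hlowt : |(t : ℝ)⁻¹| ≤ c₃ := by
      by_contra hc
      push Not at hc
      have h1 := hlow (t : ℝ)⁻¹ hc
      have hrev : eval (t : ℝ)⁻¹ gv * (t : ℝ) ^ d = eval (t : ℝ) gR := by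
        letI : Invertible (t : ℝ) := invertibleOfNonzero ht0'
        have := eval₂_reverse_mul_pow (RingHom.id ℝ) (t : ℝ) gR
        rw [invOf_eq_inv, hgRdeg] at this
        exact this
      obtain ⟨k, hk⟩ := Nat.exists_eq_add_of_le had.le
      have hk' : d - a = k := by omega
      have h3 : eval (t : ℝ)⁻¹ gv * (t : ℝ) ^ k = (D : ℝ) * ((sQ N : ℚ) : ℝ) := by
        rw [hk, pow_add, hNR] at hrev
        have : (eval (t : ℝ)⁻¹ gv * (t : ℝ) ^ k) * (t : ℝ) ^ a
            = ((D : ℝ) * ((sQ N : ℚ) : ℝ)) * (t : ℝ) ^ a := by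
          rw [← hrev]
          ring
        exact mul_right_cancel₀ (pow_ne_zero a ht0') this
      rw [eval_pow, eval_X, hk', inv_pow, div_inv_eq_mul, h3] at h1
      linarith [hDs N]
    -- arithmetic: bounded denominator
    obtain ⟨hnum, hden⟩ := num_den_dvd_of_laurentLevel ha had hN
    have hcop := isCoprime_num_den t
    refine ⟨hupt, ?_⟩
    by_cases h2v : (2 : ℤ) ∣ (t.den : ℤ)
    · -- then the numerator is odd, divides `g(0)`, and `den = |num|·|1/t| ≤ |g(0)|·c₃`
      have h2u : ¬ (2 : ℤ) ∣ t.num := by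
        intro h2u
        have := Int.isUnit_iff.mp (hcop.isUnit_of_dvd' h2u h2v)
        omega
      have hc2 : IsCoprime t.num ((2 : ℤ) ^ N !) :=
        ((Int.prime_two.coprime_iff_not_dvd).mpr h2u).symm.pow_right
      have hdvd : t.num ∣ g.coeff 0 := hc2.dvd_of_dvd_mul_left hnum
      have hle : t.num.natAbs ≤ (g.coeff 0).natAbs :=
        Nat.le_of_dvd (Int.natAbs_pos.mpr hg0) (Int.natAbs_dvd_natAbs.mpr hdvd)
      have e : (t.den : ℝ) = |(t.num : ℝ)| * |(t : ℝ)⁻¹| := by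
        have h1 : (t : ℝ) * (t.den : ℝ) = (t.num : ℝ) := by exact_mod_cast Rat.mul_den_eq_num t
        rw [← abs_mul, ← h1, mul_comm, ← mul_assoc, inv_mul_cancel₀ ht0', one_mul,
          abs_of_nonneg (by positivity)]
      refine le_trans ?_ (le_max_right _ _)
      rw [e]
      have : |(t.num : ℝ)| ≤ (((g.coeff 0).natAbs : ℕ) : ℝ) := by
        rw [← Int.cast_abs, ← Nat.cast_natAbs]
        exact_mod_cast hle
      exact mul_le_mul this hlowt (abs_nonneg _) (by positivity)
    · -- the denominator is odd and divides `lc g`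
      have hc2 : IsCoprime (t.den : ℤ) ((2 : ℤ) ^ N !) :=
        ((Int.prime_two.coprime_iff_not_dvd).mpr h2v).symm.pow_right
      have hdvd : (t.den : ℤ) ∣ g.leadingCoeff := hc2.dvd_of_dvd_mul_left hden
      have hle : t.den ≤ g.leadingCoeff.natAbs := by
        have := Nat.le_of_dvd (Int.natAbs_pos.mpr hlc) (Int.natAbs_dvd_natAbs.mpr hdvd)
        simpa using this
      refine le_trans ?_ (le_max_left _ _)
      exact_mod_cast hle
  -- each parameter carries at most one level
  refine (hT.biUnion (t := fun t => {N : ℕ | aeval t g = D * sQ N * t ^ a}) fun t ht => ?_).subset ?_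
  · refine Set.Subsingleton.finite fun N hN N' hN' => ?_
    have ht0 : t ≠ 0 := ht.1
    have e : (D : ℚ) * sQ N * t ^ a = D * sQ N' * t ^ a := hN.symm.trans hN'
    have hDq : (D : ℚ) ≠ 0 := by exact_mod_cast hD
    have hta : (t : ℚ) ^ a ≠ 0 := pow_ne_zero _ ht0
    exact sQ_injective (mul_left_cancel₀ hDq (mul_right_cancel₀ hta e))
  · rintro N ⟨t, ht0, h⟩
    simp only [Set.mem_iUnion, Set.mem_setOf_eq, exists_prop]
    exact ⟨t, ⟨ht0, N, h⟩, h⟩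

end Summit.Schanuel.Schanuel.Theorems.RootDecomp1KLevelFinite

end
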